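import Summits.QuantumFields.QCD.Theorems.RobustYangMills.Negative.NoSmallFalse
import Literature.MathematicalPhysics.QuantumFieldTheory.QuasiLocalGaugePerturbationWilson
import Literature.MathematicalPhysics.QuantumFieldTheory.BlockScaleEffectivePerturbation

/-!
# `RobustYangMills` — the tilted global perturbation `-log(1 + c e^{-t S_W})`: a (h3)-small (at `κ = 0`)
one-activity perturbation whose measure is the MIXTURE `r₁ μ_β + r₂ μ_{β+t}`

Standing disprover (`cdisprove`, gen 2) for the shared crux
`Summit.QuantumFields.QCD.Theses.NestedDissectionSea.RobustYangMills` (item stmt-QuantumFields-13897,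
rev 4).  Toolkit for the tightness theorem "`κ = 0` is not enough" (`Negative/KappaZero.lean`), built on
the cycle-1 one-activity global perturbation `globalPert` (`Negative/GlobalActivity.lean`):

* `gTilt c t s = -log(1 + c e^{-t s})`, continuity, `|gTilt| ≤ log(1+c)` on `s ≥ 0`;
* `weight_tilt`, `partitionFunction_tilt`, the mixture weights `tiltW₁`, `tiltW₂` (`r₁ + r₂ = 1`, finite)
  and **`perturbedMeasure_tilt`**: `μ_{β, W} = r₁ μ_β + r₂ μ_{β+t}`; `expectation_tilt`;
* (h2) `isReflectionPositive_tilt` (positive mixture of two reflection-positive Wilson measures);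
* (h3) AT `κ = 0`: `normLE_globalPert_zero` — `‖globalPert g‖_{b,0} ≤ sup |g ∘ S_W|`, the polymer size is
  invisible at `κ = 0`;
* the **law of total covariance** `connectedCorr_tilt`:
  `cc_W = r₁ cc_β + r₂ cc_{β+t} + r₁ r₂ (⟨A⟩_β − ⟨A⟩_{β+t})(⟨B⟩_β − ⟨B⟩_{β+t})`;
* the weight bound `tiltW_mul_ge`: `r₁ r₂ ≥ c e^{-1}/(1+c)²` whenever `t · sup S_W ≤ 1` (unitary `ρ`);
* `wilsonAction_le_of_unitary` (`S_W ≤ 2N · #plaquettes`), `connectedCorr_smul_wilson`.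
-/

noncomputable section

open MeasureTheory Filter Topology Finset
open scoped ENNReal ComplexOrder
open Literature.MathematicalPhysics.QuantumLattice Literature.MathematicalPhysics.AQFT
  Literature.MathematicalPhysics.QuantumFieldTheory

namespace Summit.QuantumFields.QCD.Theorems.RobustYangMills.Negative

section Tilt

variable {G : Type} [Group G] [TopologicalSpace G] [IsTopologicalGroup G] [CompactSpace G]
  [MeasurableSpace G] [BorelSpace G] [SecondCountableTopology G] {N : ℕ}
  (ρ : G →* Matrix (Fin N) (Fin N) ℂ) (hρ : Continuous ρ)

/-- `g(s) = -log(1 + c e^{-t s})`: turns `e^{-β S}` into `e^{-β S} + c e^{-(β+t) S}`. [folklore] -/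
def gTilt (c t : ℝ) : ℝ → ℝ := fun s => -Real.log (1 + c * Real.exp (-t * s))

/-- `1 + c e^{-ts} > 0` for `c ≥ 0`. [folklore] -/
theorem one_add_mul_exp_pos {c : ℝ} (hc : 0 ≤ c) (t s : ℝ) : 0 < 1 + c * Real.exp (-t * s) := by
  positivity

/-- `gTilt` is continuous (`c ≥ 0`). [folklore] -/
theorem continuous_gTilt {c : ℝ} (hc : 0 ≤ c) (t : ℝ) : Continuous (gTilt c t) := by
  unfold gTilt
  refine Continuous.neg (Continuous.log (by fun_prop) fun s => (one_add_mul_exp_pos hc t s).ne')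

/-- `|gTilt c t s| ≤ log (1 + c)` for `s, t, c ≥ 0`. [folklore] -/
theorem abs_gTilt_le {c t s : ℝ} (hc : 0 ≤ c) (ht : 0 ≤ t) (hs : 0 ≤ s) :
    |gTilt c t s| ≤ Real.log (1 + c) := by
  have h1 : 1 ≤ 1 + c * Real.exp (-t * s) := le_add_of_nonneg_right (by positivity)
  have h2 : 1 + c * Real.exp (-t * s) ≤ 1 + c := by
    have : Real.exp (-t * s) ≤ 1 := Real.exp_le_one_iff.2 (by nlinarith)
    nlinarith
  have hlog0 : 0 ≤ Real.log (1 + c * Real.exp (-t * s)) := Real.log_nonneg h1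
  have hlog1 : Real.log (1 + c * Real.exp (-t * s)) ≤ Real.log (1 + c) :=
    Real.log_le_log (by positivity) h2
  rw [gTilt, abs_neg, abs_of_nonneg hlog0]
  exact hlog1

variable {Lt : ℕ} [NeZero Lt]

/-- The weight of the tilted global perturbation is `wilsonWeight β + c · wilsonWeight (β + t)`. [folklore] -/
theorem weight_tilt (b : ℕ) (β : ℝ) {c : ℝ} (hc : 0 ≤ c) (t : ℝ) :
    (globalPert (Lt := Lt) ρ hρ b (gTilt c t) (continuous_gTilt hc t)).weight ρ β =
      wilsonWeight (d := 4) (L := Lt) ρ β + ENNReal.ofReal c • wilsonWeight (d := 4) (L := Lt) ρ (β + t) := by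
  rw [weight_globalPert]
  have hmeas : Measurable fun U : GaugeConfig 4 Lt G => ENNReal.ofReal (Real.exp (-β * wilsonAction ρ U)) :=
    ENNReal.measurable_ofReal.comp ((continuous_wilsonAction ρ hρ).measurable.const_mul (-β)).exp
  have hmeas' : Measurable fun U : GaugeConfig 4 Lt G => ENNReal.ofReal (Real.exp (-(β + t) * wilsonAction ρ U)) :=
    ENNReal.measurable_ofReal.comp ((continuous_wilsonAction ρ hρ).measurable.const_mul (-(β + t))).exp
  have hdens : (fun U : GaugeConfig 4 Lt G => ENNReal.ofReal
      (Real.exp (-β * wilsonAction ρ U - gTilt c t (wilsonAction ρ U)))) =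
      (fun U => ENNReal.ofReal (Real.exp (-β * wilsonAction ρ U))) +
        ENNReal.ofReal c • fun U => ENNReal.ofReal (Real.exp (-(β + t) * wilsonAction ρ U)) := by
    funext U
    simp only [Pi.add_apply, Pi.smul_apply, smul_eq_mul, gTilt]
    rw [sub_neg_eq_add, Real.exp_add, Real.exp_log (one_add_mul_exp_pos hc t _), mul_add, mul_one,
      mul_left_comm, ← Real.exp_add,
      show -β * wilsonAction ρ U + -t * wilsonAction ρ U = -(β + t) * wilsonAction ρ U by ring,
      ENNReal.ofReal_add (Real.exp_pos _).le (by positivity), ENNReal.ofReal_mul hc]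
  rw [hdens, withDensity_add_left hmeas, withDensity_smul _ hmeas']
  rfl

/-- Its partition function is `Z_β + c Z_{β+t}`. [folklore] -/
theorem partitionFunction_tilt (b : ℕ) (β : ℝ) {c : ℝ} (hc : 0 ≤ c) (t : ℝ) :
    (globalPert (Lt := Lt) ρ hρ b (gTilt c t) (continuous_gTilt hc t)).partitionFunction ρ β =
      partitionFunction (d := 4) (L := Lt) ρ β +
        ENNReal.ofReal c * partitionFunction (d := 4) (L := Lt) ρ (β + t) := by
  unfold QuasiLocalGaugePerturbation.partitionFunction
  rw [weight_tilt ρ hρ b β hc t, Measure.add_apply, Measure.smul_apply, smul_eq_mul]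
  rfl

/-- The mixture weights `r₁ = Z_β/(Z_β + cZ_{β+t})`, `r₂ = cZ_{β+t}/(Z_β + cZ_{β+t})` (as `ℝ≥0∞`). [folklore] -/
def tiltW₁ (Lt : ℕ) [NeZero Lt] (β c t : ℝ) : ℝ≥0∞ :=
  (partitionFunction (d := 4) (L := Lt) ρ β + ENNReal.ofReal c * partitionFunction (d := 4) (L := Lt) ρ (β + t))⁻¹ *
    partitionFunction (d := 4) (L := Lt) ρ β

/-- See `tiltW₁`. [folklore] -/
def tiltW₂ (Lt : ℕ) [NeZero Lt] (β c t : ℝ) : ℝ≥0∞ :=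
  (partitionFunction (d := 4) (L := Lt) ρ β + ENNReal.ofReal c * partitionFunction (d := 4) (L := Lt) ρ (β + t))⁻¹ *
    (ENNReal.ofReal c * partitionFunction (d := 4) (L := Lt) ρ (β + t))

variable {ρ}

omit [SecondCountableTopology G] in
/-- The denominator `Z_β + c Z_{β+t}` is neither `0` nor `∞`. [folklore] -/
theorem tiltDen_ne (hρ : Continuous ρ) (β c t : ℝ) :
    partitionFunction (d := 4) (L := Lt) ρ β + ENNReal.ofReal c * partitionFunction (d := 4) (L := Lt) ρ (β + t) ≠ 0 ∧
    partitionFunction (d := 4) (L := Lt) ρ β + ENNReal.ofReal c * partitionFunction (d := 4) (L := Lt) ρ (β + t) ≠ ⊤ := by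
  obtain ⟨h0, ht⟩ := partitionFunction_ne_zero_and_ne_top (d := 4) (L := Lt) ρ hρ β
  obtain ⟨-, ht'⟩ := partitionFunction_ne_zero_and_ne_top (d := 4) (L := Lt) ρ hρ (β + t)
  exact ⟨fun h => h0 (add_eq_zero.1 h).1, ENNReal.add_ne_top.2 ⟨ht, ENNReal.mul_ne_top ENNReal.ofReal_ne_top ht'⟩⟩

omit [SecondCountableTopology G] in
/-- `r₁ + r₂ = 1`. [folklore] -/
theorem tiltW_add (hρ : Continuous ρ) (β c t : ℝ) :
    tiltW₁ ρ Lt β c t + tiltW₂ ρ Lt β c t = 1 := by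
  obtain ⟨h0, ht⟩ := tiltDen_ne (Lt := Lt) hρ β c t
  unfold tiltW₁ tiltW₂
  rw [← mul_add, ENNReal.inv_mul_cancel h0 ht]

omit [SecondCountableTopology G] in
/-- `r₁ ≠ ∞`, `r₂ ≠ ∞`. [folklore] -/
theorem tiltW_ne_top (hρ : Continuous ρ) (β c t : ℝ) :
    tiltW₁ ρ Lt β c t ≠ ⊤ ∧ tiltW₂ ρ Lt β c t ≠ ⊤ := by
  have h := tiltW_add (Lt := Lt) hρ β c t
  constructor
  · intro h'; rw [h', top_add] at h; exact ENNReal.top_ne_one h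
  · intro h'; rw [h', add_top] at h; exact ENNReal.top_ne_one h

omit [SecondCountableTopology G] in
/-- The real weights sum to `1`. [folklore] -/
theorem tiltW_toReal_add (hρ : Continuous ρ) (β c t : ℝ) :
    (tiltW₁ ρ Lt β c t).toReal + (tiltW₂ ρ Lt β c t).toReal = 1 := by
  obtain ⟨h1, h2⟩ := tiltW_ne_top (Lt := Lt) hρ β c t
  rw [← ENNReal.toReal_add h1 h2, tiltW_add hρ, ENNReal.toReal_one]

/-- **The tilted global perturbation IS the mixture `r₁ μ_β + r₂ μ_{β+t}`.** [folklore] -/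
theorem perturbedMeasure_tilt (b : ℕ) (β : ℝ) {c : ℝ} (hc : 0 ≤ c) (t : ℝ) :
    (globalPert (Lt := Lt) ρ hρ b (gTilt c t) (continuous_gTilt hc t)).perturbedMeasure ρ β =
      tiltW₁ ρ Lt β c t • wilsonMeasure (d := 4) (L := Lt) ρ β +
        tiltW₂ ρ Lt β c t • wilsonMeasure (d := 4) (L := Lt) ρ (β + t) := by
  obtain ⟨hZ0, hZt⟩ := partitionFunction_ne_zero_and_ne_top (d := 4) (L := Lt) ρ hρ β
  obtain ⟨hZ0', hZt'⟩ := partitionFunction_ne_zero_and_ne_top (d := 4) (L := Lt) ρ hρ (β + t)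
  unfold QuasiLocalGaugePerturbation.perturbedMeasure tiltW₁ tiltW₂
  rw [partitionFunction_tilt ρ hρ b β hc t, weight_tilt ρ hρ b β hc t, smul_add, smul_smul]
  congr 1
  · unfold wilsonMeasure
    rw [smul_smul, mul_assoc, ENNReal.mul_inv_cancel hZ0 hZt, mul_one]
  · unfold wilsonMeasure
    rw [smul_smul, mul_assoc, mul_assoc, ENNReal.mul_inv_cancel hZ0' hZt', mul_one]

/-- Expectations under the tilted perturbation split as the mixture. [folklore] -/
theorem expectation_tilt {V : Type*} [NormedAddCommGroup V] [NormedSpace ℝ V] [CompleteSpace V]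
    (b : ℕ) (β : ℝ) {c : ℝ} (hc : 0 ≤ c) (t : ℝ) (f : GaugeConfig 4 Lt G → V)
    (h₁ : Integrable f (wilsonMeasure (d := 4) (L := Lt) ρ β))
    (h₂ : Integrable f (wilsonMeasure (d := 4) (L := Lt) ρ (β + t))) :
    (globalPert (Lt := Lt) ρ hρ b (gTilt c t) (continuous_gTilt hc t)).expectation ρ β f =
      (tiltW₁ ρ Lt β c t).toReal • (∫ U, f U ∂(wilsonMeasure (d := 4) (L := Lt) ρ β)) +
        (tiltW₂ ρ Lt β c t).toReal • ∫ U, f U ∂(wilsonMeasure (d := 4) (L := Lt) ρ (β + t)) := by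
  obtain ⟨h1, h2⟩ := tiltW_ne_top (Lt := Lt) hρ β c t
  unfold QuasiLocalGaugePerturbation.expectation
  rw [perturbedMeasure_tilt hρ b β hc t, integral_add_measure (h₁.smul_measure h1) (h₂.smul_measure h2),
    integral_smul_measure, integral_smul_measure]

/-- **(h2) for the tilted global perturbation** (`β, t, c ≥ 0`, odd torus `2S+1`, `S ≥ 1`): a positive
combination of two reflection-positive Wilson measures. [folklore] -/
theorem isReflectionPositive_tilt {S : ℕ} (hS : 1 ≤ S) (b : ℕ) {β c t : ℝ} (hβ : 0 ≤ β) (hc : 0 ≤ c)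
    (ht : 0 ≤ t) :
    (globalPert (Lt := 2 * S + 1) ρ hρ b (gTilt c t) (continuous_gTilt hc t)).IsReflectionPositive ρ β := by
  intro F hF hFb hFpos
  obtain ⟨C, hC⟩ := hFb
  rw [expectation_tilt hρ b β hc t _ (integrable_rpObs hρ β F hF hC) (integrable_rpObs hρ (β + t) F hF hC)]
  have e1 := wilsonExpectation_oddRP ρ hS hρ hβ F hF ⟨C, hC⟩ hFpos
  have e2 := wilsonExpectation_oddRP ρ hS hρ (by linarith : 0 ≤ β + t) F hF ⟨C, hC⟩ hFpos
  unfold wilsonExpectation at e1 e2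
  rw [Complex.real_smul, Complex.real_smul]
  have h1 : (0 : ℂ) ≤ ((tiltW₁ ρ (2 * S + 1) β c t).toReal : ℂ) := Complex.zero_le_real.2 ENNReal.toReal_nonneg
  have h2 : (0 : ℂ) ≤ ((tiltW₂ ρ (2 * S + 1) β c t).toReal : ℂ) := Complex.zero_le_real.2 ENNReal.toReal_nonneg
  exact add_nonneg (mul_nonneg h1 e1) (mul_nonneg h2 e2)

/-- **(h3) at `κ = 0` for a one-activity global perturbation**: if `|g(S_W(U))| ≤ M` for all `U` then
`‖globalPert g‖_{b,0} ≤ M` — at `κ = 0` the weighted norm does not see the size of the polymer. [folklore] -/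
theorem normLE_globalPert_zero (b : ℕ) (g : ℝ → ℝ) (hg : Continuous g) {M : ℝ}
    (hM : ∀ U : GaugeConfig 4 Lt G, |g (wilsonAction ρ U)| ≤ M) :
    (globalPert (Lt := Lt) ρ hρ b g hg).NormLE 0 M := by
  intro y hy
  unfold QuasiLocalGaugePerturbation.weightedSum
  have hmem : blockCorners (d := 4) (L := Lt) b ∈ polymersThrough (d := 4) (L := Lt) b y :=
    mem_polymersThrough_iff.2 ⟨mem_polymers_iff.2 subset_rfl, hy⟩
  rw [Finset.sum_eq_single_of_mem _ hmem]
  · rw [zero_mul, Real.exp_zero, mul_one]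
    exact QuasiLocalGaugePerturbation.supNorm_le _ fun U => by simpa using hM U
  · intro X _ hX
    have h0 : (globalPert (Lt := Lt) ρ hρ b g hg).supNorm X ≤ 0 :=
      QuasiLocalGaugePerturbation.supNorm_le _ fun U => by simp [hX]
    have := le_antisymm h0 (QuasiLocalGaugePerturbation.supNorm_nonneg _ X)
    rw [this, zero_mul]

/-- **Law of total covariance for the mixture**: the connected correlation under the tilted
perturbation equals `r₁ cc_β + r₂ cc_{β+t} + r₁ r₂ (⟨A⟩_β − ⟨A⟩_{β+t})(⟨B⟩_β − ⟨B⟩_{β+t})`. [folklore] -/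
theorem connectedCorr_tilt {S : ℕ} (b : ℕ) (β : ℝ) {c : ℝ} (hc : 0 ≤ c) (t : ℝ) (A B : YMSpecies G) (n : ℕ) :
    (globalPert (Lt := 2 * S + 1) ρ hρ b (gTilt c t) (continuous_gTilt hc t)).connectedCorr ρ β A.F B.F n =
      (tiltW₁ ρ (2 * S + 1) β c t).toReal * latticeConnectedCorr ρ β (2 * S + 1) A.F B.F n +
      (tiltW₂ ρ (2 * S + 1) β c t).toReal * latticeConnectedCorr ρ (β + t) (2 * S + 1) A.F B.F n +
      (tiltW₁ ρ (2 * S + 1) β c t).toReal * (tiltW₂ ρ (2 * S + 1) β c t).toReal *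
        (((∫ U, A.F (torusLift (2 * S + 1) U) ∂(wilsonMeasure (d := 4) (L := 2 * S + 1) ρ β)) -
            ∫ U, A.F (torusLift (2 * S + 1) U) ∂(wilsonMeasure (d := 4) (L := 2 * S + 1) ρ (β + t))) *
          ((∫ U, B.F (torusLift (2 * S + 1) U) ∂(wilsonMeasure (d := 4) (L := 2 * S + 1) ρ β)) -
            ∫ U, B.F (torusLift (2 * S + 1) U) ∂(wilsonMeasure (d := 4) (L := 2 * S + 1) ρ (β + t)))) := by
  obtain ⟨CA, hCA⟩ := A.bounded
  obtain ⟨CB, hCB⟩ := B.bounded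
  have hmA : Measurable fun U : GaugeConfig 4 (2 * S + 1) G => A.F (torusLift (2 * S + 1) U) :=
    A.measurable.comp (measurable_torusLift _)
  have hmB : Measurable fun U : GaugeConfig 4 (2 * S + 1) G =>
      B.F (configShift (-Pi.single 0 (n : ℤ)) (torusLift (2 * S + 1) U)) :=
    B.measurable.comp ((configShift _).measurable.comp (measurable_torusLift _))
  have hmAB : Measurable fun U : GaugeConfig 4 (2 * S + 1) G => A.F (torusLift (2 * S + 1) U) *
      B.F (configShift (-Pi.single 0 (n : ℤ)) (torusLift (2 * S + 1) U)) := hmA.mul hmB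
  have hbAB : ∀ U : GaugeConfig 4 (2 * S + 1) G, |A.F (torusLift (2 * S + 1) U) *
      B.F (configShift (-Pi.single 0 (n : ℤ)) (torusLift (2 * S + 1) U))| ≤ CA * CB := fun U => by
    rw [abs_mul]
    exact mul_le_mul (hCA _) (hCB _) (abs_nonneg _)
      ((abs_nonneg (A.F (torusLift (2 * S + 1) U))).trans (hCA _))
  have hmB' : Measurable fun U : GaugeConfig 4 (2 * S + 1) G => B.F (torusLift (2 * S + 1) U) :=
    B.measurable.comp (measurable_torusLift _)
  have hsum := tiltW_toReal_add (Lt := 2 * S + 1) hρ β c t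
  unfold QuasiLocalGaugePerturbation.connectedCorr latticeConnectedCorr
  rw [expectation_tilt hρ b β hc t _ (integrable_lift hρ β hmAB hbAB) (integrable_lift hρ (β + t) hmAB hbAB),
    expectation_tilt hρ b β hc t _ (integrable_lift hρ β hmA (fun U => hCA _))
      (integrable_lift hρ (β + t) hmA (fun U => hCA _)),
    expectation_tilt hρ b β hc t _ (integrable_lift hρ β hmB' (fun U => hCB _))
      (integrable_lift hρ (β + t) hmB' (fun U => hCB _))]
  simp only [smul_eq_mul]
  set r₁ := (tiltW₁ ρ (2 * S + 1) β c t).toReal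
  set r₂ := (tiltW₂ ρ (2 * S + 1) β c t).toReal
  have hr₂ : r₂ = 1 - r₁ := by linarith
  rw [hr₂]
  ring

include hρ in
/-- **Uniform bounds on the mixture weights**: if `0 ≤ t`, `0 ≤ β`, the action is bounded by `M ≥ 0`
with `t M ≤ 1`, then `r₁ r₂ ≥ c e^{-1} / (1 + c)²` (`c ≥ 0`). [folklore] -/
theorem tiltW_mul_ge (hρu : ∀ g, ρ g ∈ Matrix.unitaryGroup (Fin N) ℂ) {β c t M : ℝ} (hc : 0 ≤ c)
    (ht : 0 ≤ t) (hM : ∀ U : GaugeConfig 4 Lt G, wilsonAction ρ U ≤ M) (htM : t * M ≤ 1) :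
    c * Real.exp (-1) / (1 + c) ^ 2 ≤ (tiltW₁ ρ Lt β c t).toReal * (tiltW₂ ρ Lt β c t).toReal := by
  obtain ⟨hZ0, hZt⟩ := partitionFunction_ne_zero_and_ne_top (d := 4) (L := Lt) ρ hρ β
  obtain ⟨hZ0', hZt'⟩ := partitionFunction_ne_zero_and_ne_top (d := 4) (L := Lt) ρ hρ (β + t)
  set Z₁ := partitionFunction (d := 4) (L := Lt) ρ β with hZ₁
  set Z₂ := partitionFunction (d := 4) (L := Lt) ρ (β + t) with hZ₂
  -- nonnegativity of the action (unitary `ρ`)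
  have hS0 : ∀ U : GaugeConfig 4 Lt G, 0 ≤ wilsonAction ρ U := fun U => by
    rw [wilsonAction_eq_sum_plaquetteCost]
    exact Finset.sum_nonneg fun p _ => plaquetteCost_nonneg_of_unitary ρ hρu U p
  -- the two comparisons of weights
  have hle : Z₂ ≤ Z₁ := by
    simp only [hZ₁, hZ₂, partitionFunction, wilsonWeight]
    refine (withDensity_mono (Eventually.of_forall fun U => ?_)) Set.univ
    refine ENNReal.ofReal_le_ofReal (Real.exp_le_exp.2 ?_)
    have := hS0 U
    nlinarith
  have hmeasβ : Measurable fun U : GaugeConfig 4 Lt G => ENNReal.ofReal (Real.exp (-β * wilsonAction ρ U)) :=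
    ENNReal.measurable_ofReal.comp ((continuous_wilsonAction ρ hρ).measurable.const_mul (-β)).exp
  have hge : ENNReal.ofReal (Real.exp (-1)) * Z₁ ≤ Z₂ := by
    have e : ENNReal.ofReal (Real.exp (-1)) * Z₁ =
        ((Measure.pi fun _ : Edge 4 Lt => haarProbability G).withDensity
          (ENNReal.ofReal (Real.exp (-1)) • fun U => ENNReal.ofReal (Real.exp (-β * wilsonAction ρ U)))) Set.univ := by
      rw [withDensity_smul _ hmeasβ, Measure.smul_apply, smul_eq_mul]
      rfl
    rw [e]
    show _ ≤ wilsonWeight (d := 4) (L := Lt) ρ (β + t) Set.univ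
    unfold wilsonWeight
    refine Measure.le_iff'.1 (withDensity_mono (Eventually.of_forall fun U => ?_)) Set.univ
    simp only [Pi.smul_apply, smul_eq_mul]
    rw [← ENNReal.ofReal_mul (Real.exp_pos _).le, ← Real.exp_add]
    refine ENNReal.ofReal_le_ofReal (Real.exp_le_exp.2 ?_)
    have h1 := hS0 U
    have h2 : t * wilsonAction ρ U ≤ 1 := (mul_le_mul_of_nonneg_left (hM U) ht).trans htM
    nlinarith
  -- pass to real numbers
  set z₁ := Z₁.toReal with hz₁def
  set z₂ := Z₂.toReal with hz₂def
  have hz₁ : 0 < z₁ := ENNReal.toReal_pos hZ0 hZt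
  have hz₂ : 0 < z₂ := ENNReal.toReal_pos hZ0' hZt'
  have h21 : z₂ ≤ z₁ := ENNReal.toReal_mono hZt hle
  have h12 : Real.exp (-1) * z₁ ≤ z₂ := by
    have := ENNReal.toReal_mono hZt' hge
    rwa [ENNReal.toReal_mul, ENNReal.toReal_ofReal (Real.exp_pos _).le] at this
  have hcZ : ENNReal.ofReal c * Z₂ ≠ ⊤ := ENNReal.mul_ne_top ENNReal.ofReal_ne_top hZt'
  have hr₁ : (tiltW₁ ρ Lt β c t).toReal = (z₁ + c * z₂)⁻¹ * z₁ := by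
    unfold tiltW₁
    rw [ENNReal.toReal_mul, ENNReal.toReal_inv, ENNReal.toReal_add hZt hcZ, ENNReal.toReal_mul,
      ENNReal.toReal_ofReal hc]
  have hr₂ : (tiltW₂ ρ Lt β c t).toReal = (z₁ + c * z₂)⁻¹ * (c * z₂) := by
    unfold tiltW₂
    rw [ENNReal.toReal_mul, ENNReal.toReal_inv, ENNReal.toReal_add hZt hcZ, ENNReal.toReal_mul,
      ENNReal.toReal_ofReal hc]
  rw [hr₁, hr₂]
  have hD : 0 < z₁ + c * z₂ := by positivity
  have hA : z₁ + c * z₂ ≤ (1 + c) * z₁ := by nlinarith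
  have hB : (z₁ + c * z₂) * (z₁ + c * z₂) ≤ ((1 + c) * z₁) * ((1 + c) * z₁) :=
    mul_le_mul hA hA hD.le (by positivity)
  rw [show (z₁ + c * z₂)⁻¹ * z₁ * ((z₁ + c * z₂)⁻¹ * (c * z₂)) =
      (z₁ * (c * z₂)) / ((z₁ + c * z₂) * (z₁ + c * z₂)) by field_simp]
  rw [le_div_iff₀ (by positivity), div_mul_eq_mul_div, div_le_iff₀ (by positivity)]
  calc c * Real.exp (-1) * ((z₁ + c * z₂) * (z₁ + c * z₂))
      ≤ c * Real.exp (-1) * (((1 + c) * z₁) * ((1 + c) * z₁)) :=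
        mul_le_mul_of_nonneg_left hB (by positivity)
    _ = (c * (1 + c) ^ 2) * (Real.exp (-1) * z₁) * z₁ := by ring
    _ ≤ (c * (1 + c) ^ 2) * z₂ * z₁ :=
        mul_le_mul_of_nonneg_right (mul_le_mul_of_nonneg_left h12 (by positivity)) hz₁.le
    _ = z₁ * (c * z₂) * (1 + c) ^ 2 := by ring

omit [TopologicalSpace G] [IsTopologicalGroup G] [CompactSpace G] [MeasurableSpace G] [BorelSpace G]
  [SecondCountableTopology G] in
/-- For unitary `ρ` the Wilson action is at most `2N` per plaquette. [folklore] -/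
theorem wilsonAction_le_of_unitary {d L : ℕ} [NeZero L] (hρu : ∀ g, ρ g ∈ Matrix.unitaryGroup (Fin N) ℂ)
    (U : GaugeConfig d L G) :
    wilsonAction ρ U ≤ 2 * N * Fintype.card (Plaquette d L) := by
  rw [wilsonAction_eq_sum_plaquetteCost]
  calc ∑ p : Plaquette d L, plaquetteCost ρ U p ≤ ∑ _p : Plaquette d L, (2 * N : ℝ) :=
        Finset.sum_le_sum fun p _ => (le_abs_self _).trans (abs_plaquetteCost_le_of_unitary ρ hρu U p)
    _ = 2 * N * Fintype.card (Plaquette d L) := by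
        rw [Finset.sum_const, Finset.card_univ, nsmul_eq_mul]; ring

/-- Connected correlations under the coupling shift are the Wilson ones at `β + t`. [folklore] -/
theorem connectedCorr_smul_wilson {S : ℕ} (b : ℕ) (β t : ℝ) (A B : LGConfig 4 G → ℝ) (n : ℕ) :
    (t • QuasiLocalGaugePerturbation.wilson (d := 4) (L := 2 * S + 1) ρ hρ b).connectedCorr ρ β A B n =
      latticeConnectedCorr ρ (β + t) (2 * S + 1) A B n := by
  unfold QuasiLocalGaugePerturbation.connectedCorr QuasiLocalGaugePerturbation.expectation
    latticeConnectedCorr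
  rw [QuasiLocalGaugePerturbation.perturbedMeasure_smul_wilson]

end Tilt


end Summit.QuantumFields.QCD.Theorems.RobustYangMills.Negative

end
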